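import Literature.NumberTheory.EllipticCurves.ToricTwoVariablePAdicLFunctionUpTo
import Literature.NumberTheory.EllipticCurves.IntSeriesIdentityPrinciple
import HarnessLib

/-!
# SupplyGridG59 — utd-idea g59 support sketch for crux 24207 (`RationalSplitIMCInclusionAtThree`)

Answer to LEAD-CENSUS-g0 §4 ("disprover-wanted: is the typed interpolation set of
`IsToricTwoVarLFunction[UpTo]` through the PAIR Zariski-dense?").

* §1 A FIBRED identity principle for `𝒪_{ℂ_p}⟦T₁⟧⟦T₂⟧` and `R₀⟦T₁⟧⟦T₂⟧`: it suffices that for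
  infinitely many values `y` of the INNER variable (in a closed disc) the fibre `{x : L(x, y) = 0}` is
  infinite (in a closed disc) — the fibres may depend on `y`; no product grid `D₁ × D₂` is needed.
  (The tree's `eq_zero_of_infinite_zeros₂` is the product-grid case.) Sorry-free.
* §2 `ToricFibreSupply` — the typed density hypothesis in the binder currency of
  `IsToricTwoVarLFunction`, and the uniqueness corollaries
  `IsToricTwoVarLFunction.eq_of_fibreSupply`, `IsToricTwoVarLFunctionUpTo.eq_of_fibreSupply`
  (same constant). Sorry-free.
* §3 `UnramifiedTypeSupply`, `PairAvatarSupply` — the two arithmetic inputs (typed `Prop`s, informal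
  proofs in SUPPLY-GRID-utd-idea-g59.md): unramified Hecke characters of `K` of every type `(a, −b)`
  with `a ≡ b ≡ 0 (mod 2)` exist, and after a class-group twist their `3`-adic avatars factor
  through `Γ_K` (= through any pair). Why fibred and not grid: in a `𝔭`-adapted frame
  (`κ₁` unramified outside `𝔭`, `γ₂ ∈ ker κ₁`) the characters of type `(−a, 0)` kill `γ₂`, so over a
  FIXED inner value `y = ψ̂(γ₂) − 1` the outer values `x = ψ̂η^i(γ₁) − 1` are infinitely many; a
  character killing `γ₁` exists only when `γ₁` lies on a ℚ-rational line of `Γ_K ⊗ ℚ₃`, which a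
  general adapted frame does not grant — so the interpolation set is fibred-infinite, not a grid.
-/

noncomputable section

open scoped MatrixGroups ModularForm Topology
open Filter CongruenceSubgroup NumberField IsDedekindDomain Field Polynomial
open Literature.NumberTheory.GaloisRepresentations
open Literature.NumberTheory.EllipticCurves
open Literature.NumberTheory.EllipticCurves.IntSeries

namespace Summit.BirchSwinnertonDyer.BirchSwinnertonDyer.Cruxes.RationalSplitIMCInclusionAtThree.SupplyGridG59

universe u

/-! ## §1 The fibred identity principle -/

section Fibre

variable {p : ℕ} [Fact p.Prime]

/-- **Fibred identity principle, zeros form, `𝒪_{ℂ_p}⟦T₁⟧⟦T₂⟧`.** If for every `a` in an infinite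
set `D₂` of inner values (`‖a‖ ≤ ‖ϖ‖ < 1`) the outer fibre `{x : ‖x‖ ≤ ‖ϖ‖, G(x, a) = 0}` is infinite,
then `G = 0`. Proof: the line `T₂ = a` of `G` is the line `T₁ = a` of `Gᵗ`; it vanishes
(`lineSubst_eq_zero_of_infinite_zeros`), so every coefficient series `[T₁^k]G ∈ 𝒪⟦T₂⟧` has the
infinitely many zeros `D₂`. -/
theorem int_eq_zero_of_infinite_zeros₂_fibre {G : PowerSeries (PowerSeries (PadicComplexInt p))}
    {ϖ : ℂ_[p]} (hϖ0 : ϖ ≠ 0) (hϖ : ‖ϖ‖ < 1) {D₂ : Set (PadicComplexInt p)} (hD₂ : D₂.Infinite)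
    (hD₂ϖ : ∀ a ∈ D₂, ‖(a : ℂ_[p])‖ ≤ ‖ϖ‖)
    (h : ∀ a ∈ D₂, {x : ℂ_[p] | ‖x‖ ≤ ‖ϖ‖ ∧ IntSeries.HasValueAt₂ G x a 0}.Infinite) : G = 0 := by
  -- every line `T₂ = a`, `a ∈ D₂`, vanishes (as the line `T₁ = a` of the transpose)
  have hline : ∀ a ∈ D₂, lineSubst a (transpose G) = 0 := fun a ha =>
    lineSubst_eq_zero_of_infinite_zeros (transpose G) ((hD₂ϖ a ha).trans_lt hϖ) hϖ0 hϖ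
      ((h a ha).mono fun x hx => ⟨hx.1, (hasValueAt₂_transpose_iff G a x 0).mpr hx.2⟩)
  -- hence every coefficient series `[T₁^k] G` vanishes on `D₂`
  have hcoeff : ∀ k : ℕ, PowerSeries.coeff k G = 0 := by
    intro k
    refine eq_zero_of_infinite_zeros hϖ0 hϖ ((hD₂.image Subtype.coe_injective.injOn).mono ?_)
    rintro x ⟨a, ha, rfl⟩
    refine ⟨hD₂ϖ a ha, ?_⟩
    have hv := hasValueAt_coeff_transpose (transpose G) ((hD₂ϖ a ha).trans_lt hϖ) k
    rw [hline a ha, map_zero, transpose_transpose] at hv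
    simpa using hv
  exact PowerSeries.ext fun k => by rw [hcoeff k, map_zero]

/-- **Fibred identity principle, zeros form, `R₀⟦T₁⟧⟦T₂⟧`** (inner values `y ∈ D₂ ⊆ ℂ_p` with
`‖y‖ ≤ ‖ϖ‖`; transported through `UnrSeries.toInt₂`). -/
theorem unr_eq_zero_of_infinite_zeros₂_fibre {L : PowerSeries (UnrSeries p)} {ϖ : ℂ_[p]}
    (hϖ0 : ϖ ≠ 0) (hϖ : ‖ϖ‖ < 1) {D₂ : Set ℂ_[p]} (hD₂ : D₂.Infinite)
    (hD₂ϖ : ∀ y ∈ D₂, ‖y‖ ≤ ‖ϖ‖)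
    (h : ∀ y ∈ D₂, {x : ℂ_[p] | ‖x‖ ≤ ‖ϖ‖ ∧ UnrSeries.HasValueAt₂ L x y 0}.Infinite) : L = 0 := by
  apply UnrSeries.toInt₂_injective
  rw [map_zero]
  set D₂' : Set (PadicComplexInt p) := {c | (c : ℂ_[p]) ∈ D₂} with hD₂'
  have hD₂'inf : D₂'.Infinite := by
    intro hfin
    apply hD₂
    refine (hfin.image (fun c : PadicComplexInt p ↦ (c : ℂ_[p]))).subset fun y hy ↦ ?_
    have hy1 : y ∈ PadicComplexInt p :=
      mem_padicComplexInt_iff.mpr ((hD₂ϖ y hy).trans hϖ.le)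
    exact ⟨⟨y, hy1⟩, hy, rfl⟩
  refine int_eq_zero_of_infinite_zeros₂_fibre hϖ0 hϖ hD₂'inf (fun c hc ↦ hD₂ϖ _ hc) fun c hc ↦
    (h _ hc).mono fun x hx ↦ ⟨hx.1, ?_⟩
  exact (UnrSeries.hasValueAt₂_iff_toInt₂ L _ _ _).mp hx.2

/-- **Fibred identity principle, agreement form, `R₀⟦T₁⟧⟦T₂⟧`**: two series with a common value at
every point of a fibred-infinite set (infinitely many inner values `y` in a closed disc, over each an
infinite set of outer values `x` in the closed disc, depending on `y`) are equal. -/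
theorem unr_eq_of_infinite_hasValueAt₂_eq_fibre {L L' : PowerSeries (UnrSeries p)} {ϖ : ℂ_[p]}
    (hϖ0 : ϖ ≠ 0) (hϖ : ‖ϖ‖ < 1) {D₂ : Set ℂ_[p]} (hD₂ : D₂.Infinite)
    (hD₂ϖ : ∀ y ∈ D₂, ‖y‖ ≤ ‖ϖ‖)
    (h : ∀ y ∈ D₂, {x : ℂ_[p] | ‖x‖ ≤ ‖ϖ‖ ∧ ∃ v : ℂ_[p],
      UnrSeries.HasValueAt₂ L x y v ∧ UnrSeries.HasValueAt₂ L' x y v}.Infinite) : L = L' := by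
  refine sub_eq_zero.mp (unr_eq_zero_of_infinite_zeros₂_fibre hϖ0 hϖ hD₂ hD₂ϖ fun y hy ↦
    (h y hy).mono fun x hx ↦ ⟨hx.1, ?_⟩)
  obtain ⟨v, hv, hv'⟩ := hx.2
  simpa using hv.sub hv'

end Fibre

/-! ## §2 The typed density hypothesis and uniqueness of toric frames -/

section Toric

variable {K : Type u} [Field K] [NumberField K] {N : ℕ} {p : ℕ} [Fact p.Prime]

/-- **`ToricFibreSupply`** — the interpolation set of `IsToricTwoVarLFunction ι 𝔭 𝔭' κ₁ κ₂ γ₁ γ₂ f …`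
is FIBRED-INFINITE in a closed bidisc: there are `ϖ ≠ 0`, `‖ϖ‖ < 1`, and infinitely many inner
values `y = r(γ₂) − 1`, `‖y‖ ≤ ‖ϖ‖`, over each of which infinitely many outer values `x = r(γ₁) − 1`,
`‖x‖ ≤ ‖ϖ‖`, are realised by an interpolation datum `(ψ, a, b, r, L)` of the frame: `ψ` unramified of
type `(a, −b)` (tree convention), `a, b ≥ 1`, `r` a `p`-adic avatar of `ψ` through the pair, `L` an
entire continuation of `L(f/K, ψ, s)`. (Independent of `𝔭, 𝔭', Ω_K, Ω_p`: only the POINTS matter.)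
In a `𝔭`-adapted frame this holds — SUPPLY-GRID-utd-idea-g59.md §2 (characters of type `(−a, 0)` kill
`γ₂ ∈ ker κ₁`; `a ≡ b ≡ 0 (2)`; class-group twist; Jacquet continuation). A hypothesis; nothing asserted. -/
def ToricFibreSupply (ι : PadicAlgCl p ≃+* ℂ) (κ₁ κ₂ : ZpExtension K p) (γ₁ γ₂ : absoluteGaloisGroup K)
    (f : CuspForm (Gamma0 N) 2) : Prop :=
  ∃ ϖ : ℂ_[p], ϖ ≠ 0 ∧ ‖ϖ‖ < 1 ∧ ∃ D₂ : Set ℂ_[p], D₂.Infinite ∧ (∀ y ∈ D₂, ‖y‖ ≤ ‖ϖ‖) ∧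
    ∀ y ∈ D₂, {x : ℂ_[p] | ‖x‖ ≤ ‖ϖ‖ ∧
      ∃ (ψ : HeckeCharacter K) (a b : ℕ) (r : FramedGaloisRep K (PadicAlgCl p) 1) (L : ℂ → ℂ),
        1 ≤ a ∧ 1 ≤ b ∧ ψ.HasInfinityType (fun _ ↦ (a : ℤ)) (fun _ ↦ -(b : ℤ)) ∧
        (∀ w : HeightOneSpectrum (𝓞 K), ψ.IsUnramifiedAt w) ∧ IsPAdicAvatarOf ι ψ r ∧
        FactorsThroughPair κ₁ κ₂ r ∧ Differentiable ℂ L ∧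
        (∀ s : ℂ, (a : ℝ) + 2 < s.re → L s = rankinSelbergEulerProductHecke f ψ s) ∧
        avatarValueAt r γ₁ - 1 = x ∧ avatarValueAt r γ₂ - 1 = y}.Infinite

variable {ι : PadicAlgCl p ≃+* ℂ} {𝔭 𝔭' : HeightOneSpectrum (𝓞 K)} {κ₁ κ₂ : ZpExtension K p}
  {γ₁ γ₂ : absoluteGaloisGroup K} {f : CuspForm (Gamma0 N) 2} {ΩK : ℂ} {Ωp : ℂ_[p]}
  {L₂ L₂' : PowerSeries (UnrSeries p)} {C : ℂ_[p]}

/-- **Uniqueness of the toric two-variable `L`-function in a fibred-dense frame**: under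
`ToricFibreSupply`, two series with Castella–Wan's interpolation property at the same data coincide —
the DENSITY half of LEAD-CENSUS-g0 §4 (the `∀ L₂` of `stub_ratCombDivisibility[UpTo]` then ranges over
at most one series per `(frame, Ω_K, Ω_p[, C])`). -/
theorem IsToricTwoVarLFunction.eq_of_fibreSupply (hS : ToricFibreSupply ι κ₁ κ₂ γ₁ γ₂ f)
    (hL : IsToricTwoVarLFunction ι 𝔭 𝔭' κ₁ κ₂ γ₁ γ₂ f ΩK Ωp L₂)
    (hL' : IsToricTwoVarLFunction ι 𝔭 𝔭' κ₁ κ₂ γ₁ γ₂ f ΩK Ωp L₂') : L₂ = L₂' := by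
  obtain ⟨ϖ, hϖ0, hϖ, D₂, hD₂, hD₂ϖ, hfib⟩ := hS
  refine unr_eq_of_infinite_hasValueAt₂_eq_fibre hϖ0 hϖ hD₂ hD₂ϖ fun y hy ↦
    (hfib y hy).mono fun x hx ↦ ⟨hx.1, ?_⟩
  obtain ⟨ψ, a, b, r, L, ha, hb, hinf, hunr, hr, hκ, hLd, hLe, hx1, hy1⟩ := hx.2
  have h1 := hL ψ a b ha hb hinf hunr r hr hκ L hLd hLe
  have h2 := hL' ψ a b ha hb hinf hunr r hr hκ L hLd hLe
  rw [hx1, hy1] at h1 h2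
  exact ⟨_, h1, h2⟩

/-- **Same, `♯`-currency with a common constant `C`**: under `ToricFibreSupply`, two `UpTo C` frames at
the same data coincide. (For constants `C ≠ C'` the two series satisfy `C'·L₂(x,y) = C·L₂'(x,y)` at
every supply point, hence — after scaling into `𝒪_{ℂ_p}⟦T₁⟧⟦T₂⟧` — `C'·L₂ = C·L₂'`; not typed here.) -/
theorem IsToricTwoVarLFunctionUpTo.eq_of_fibreSupply (hS : ToricFibreSupply ι κ₁ κ₂ γ₁ γ₂ f)
    (hL : IsToricTwoVarLFunctionUpTo C ι 𝔭 𝔭' κ₁ κ₂ γ₁ γ₂ f ΩK Ωp L₂)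
    (hL' : IsToricTwoVarLFunctionUpTo C ι 𝔭 𝔭' κ₁ κ₂ γ₁ γ₂ f ΩK Ωp L₂') : L₂ = L₂' := by
  obtain ⟨ϖ, hϖ0, hϖ, D₂, hD₂, hD₂ϖ, hfib⟩ := hS
  refine unr_eq_of_infinite_hasValueAt₂_eq_fibre hϖ0 hϖ hD₂ hD₂ϖ fun y hy ↦
    (hfib y hy).mono fun x hx ↦ ⟨hx.1, ?_⟩
  obtain ⟨ψ, a, b, r, L, ha, hb, hinf, hunr, hr, hκ, hLd, hLe, hx1, hy1⟩ := hx.2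
  have h1 := hL ψ a b ha hb hinf hunr r hr hκ L hLd hLe
  have h2 := hL' ψ a b ha hb hinf hunr r hr hκ L hLd hLe
  rw [hx1, hy1] at h1 h2
  exact ⟨_, h1, h2⟩

end Toric

/-! ## §3 The two arithmetic inputs of the supply (typed; informal proofs in the memo) -/

section Supply

variable (K : Type u) [Field K] [NumberField K] {p : ℕ} [Fact p.Prime]

/-- **S-a `UnramifiedTypeSupply K`**: for all EVEN `a, b ≥ 2` there is an idelic Hecke character of `K`
unramified at every finite place of infinity type `(a, −b)` (tree convention
`HasInfinityType (fun _ ↦ a) (fun _ ↦ −b)`). For `K` imaginary quadratic with `w_K = 2` (automatic when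
`3` splits) this is Weil/Chevalley: an infinity type is realised with conductor `1` iff it kills
`𝓞_K^× = {±1}`, i.e. iff `a ≡ b (mod 2)`. [cite: Weil 1956, §1 (characters of type A₀)]
[cite: Serre 1968, Abelian ℓ-adic representations, II.2.3–II.3.3] A hypothesis; nothing asserted. -/
def UnramifiedTypeSupply : Prop :=
  ∀ a b : ℕ, 2 ≤ a → 2 ≤ b → Even a → Even b →
    ∃ ψ : HeckeCharacter K, ψ.HasInfinityType (fun _ ↦ (a : ℤ)) (fun _ ↦ -(b : ℤ)) ∧
      ∀ w : HeightOneSpectrum (𝓞 K), ψ.IsUnramifiedAt w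

/-- **S-b `PairAvatarSupply`**: for all EVEN `a, b ≥ 2` there is such a character whose `p`-adic avatar
`r` (`IsPAdicAvatarOf ι ψ r`, which exists and is unique for algebraic `ψ`:
`Theorems/PrintCf2SplitBadTwoAvatarRigidity.exists_isPAdicAvatarOf`) FACTORS THROUGH THE PAIR. Proof
sketch (memo §2): `G = Gal(K(p^∞)/K)` is an extension of `Cl_K` by `U = (𝓞_𝔭^× × 𝓞_𝔭̄^×)/{±1}`;
`ψ̂|_U = (u₁,u₂) ↦ u₁^{∓a} u₂^{±b}` kills `U_tors = μ₂` iff `a` (hence `b`) is even; then `ψ̂|_{G_tors}`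
factors through `G_tors/U_tors ↪ Cl_K`, and twisting `ψ` by the inverse of an extension of that
class-group character keeps type and conductor and makes `ψ̂` trivial on `G_tors`, i.e. factor through
`Γ_K = G/G_tors`, i.e. through `pairKer κ₁ κ₂` for ANY top-generator pair. A hypothesis; nothing asserted. -/
def PairAvatarSupply (ι : PadicAlgCl p ≃+* ℂ) (κ₁ κ₂ : ZpExtension K p) : Prop :=
  ∀ a b : ℕ, 2 ≤ a → 2 ≤ b → Even a → Even b →
    ∃ (ψ : HeckeCharacter K) (r : FramedGaloisRep K (PadicAlgCl p) 1),
      ψ.HasInfinityType (fun _ ↦ (a : ℤ)) (fun _ ↦ -(b : ℤ)) ∧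
      (∀ w : HeightOneSpectrum (𝓞 K), ψ.IsUnramifiedAt w) ∧ IsPAdicAvatarOf ι ψ r ∧
      FactorsThroughPair κ₁ κ₂ r

end Supply

end Summit.BirchSwinnertonDyer.BirchSwinnertonDyer.Cruxes.RationalSplitIMCInclusionAtThree.SupplyGridG59

end
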